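import Literature.Computability.AlgebraicComplexity.DepthThreeChasmProofs
import HarnessLib

/-!
# Crux `Depth3Chasm` (stmt-ValiantsHypothesis-5935), line `registered` (`Cruxes/Depth3Chasm/Lines/birth.lean`)
# — registered stub `stub_paddedChasm`: the depth-three chasm with a free size parameter

**Claim settled.** For every exponent `a` there is a constant `K` such that every
`f ∈ ℂ[τ]`, `τ` an arbitrary finite type of variables, with `deg f ≤ d ≤ m ^ a + a`,
`#τ ≤ m ^ a + a` and fan-in-two complexity `L(f) ≤ s` — `m` a FREE size parameter — is computed
by an arithmetic circuit of product-depth `≤ 1` (a `ΣΠΣ` circuit) with at most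
`2 ^ (K ⌊√(d (log₂ m + 1)(log₂ s + 1))⌋ + K)` wires.

**Proof.** The `Fin n`-form of the depth-three chasm (Tavenas 2015, Cor. 1, sharpening
Gupta–Kamath–Kayal–Saptharishi 2016, Thm. 1.1) is discharged in the tree as
`Literature.Computability.AlgebraicComplexity.sigmaPiSigma_edgeSize_le_of_complexity_holds`
(`DepthThreeChasmProofs.lean`), for polynomials in `Fin n` variables with `d ≤ n ^ a + a`, `n` the
NUMBER of variables.  Pad: embed `ι : τ ↪ Fin (#τ + m)`; then `rename ι f` has the same degree,
complexity `≤ s` (`complexity_rename_le_holds'`) and lives on `N := #τ + m ≥ m` variables, so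
`d ≤ N ^ a + a` and the `Fin`-form fact (same exponent `a`, constant `K₀`) yields a `ΣΠΣ` circuit
for `rename ι f` with `≤ 2 ^ (K₀ ⌊√(d (log₂ N + 1)(log₂ s + 1))⌋ + K₀)` wires.  Renaming that
circuit back along a left inverse `ρ` of `ι` (`τ` nonempty; for empty `τ` the polynomial is a
constant and a gate-free circuit does it) keeps wires and product-depth
(`DepthThreeChasm.edgeSize_rename`, `DepthThreeChasm.productDepth_rename`) and computes
`rename (ρ ∘ ι) f = f` (`ArithCircuit.eval_rename_apply`).  Finally
`log₂ N + 1 ≤ (3a + 6)(log₂ m + 1)` (`PaddedChasm.lg_card_add_le`, from `#τ + m ≤ 2 (m+2)^(a+1)`)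
and `⌊√(C X)⌋ ≤ C ⌊√X⌋ + C` give the stated bound with `K := K₀ (3a + 6) + K₀`.

Unconditional (axioms `propext`, `Classical.choice`, `Quot.sound`).  References: S. Tavenas,
*Improved bounds for reduction to depth 4 and depth 3*, Inform. Comput. 240 (2015), Cor. 1;
A. Gupta, P. Kamath, N. Kayal, R. Saptharishi, *Arithmetic circuits: a chasm at depth three*,
SIAM J. Comput. 45 (2016), Thm. 1.1; P. Bürgisser, *Completeness and Reduction in Algebraic
Complexity Theory* (2000), Rem. 2.2 (renaming variables).
-/

-- layout Summits/ValiantsHypothesis/ValiantsHypothesis forces the duplicated namespace component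
set_option linter.dupNamespace false

noncomputable section

namespace Summit.ValiantsHypothesis.ValiantsHypothesis.Theorems.ChowBorderDepth3Depth3Chasm

open MvPolynomial
open Literature.Computability.AlgebraicComplexity
open Literature.Computability.AlgebraicComplexity.DepthThree

namespace PaddedChasm

/-- The padding bookkeeping: if `N ≤ m ^ a + a` then `lg (N + m) ≤ (3a + 6) · lg m`
(`lg x = ⌊log₂ x⌋ + 1`). [folklore] -/
theorem lg_card_add_le {N m a : ℕ} (hN : N ≤ m ^ a + a) : lg (N + m) ≤ (3 * a + 6) * lg m := by
  have hp : m ^ a + a + 1 ≤ (m + 2) ^ (a + 1) := pow_add_le_pow m a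
  have hm : m ≤ (m + 2) ^ (a + 1) :=
    calc m ≤ m + 2 := Nat.le_add_right _ _
      _ = (m + 2) ^ 1 := (pow_one _).symm
      _ ≤ (m + 2) ^ (a + 1) := Nat.pow_le_pow_right (Nat.succ_pos _) (Nat.le_add_left 1 a)
  have h1 : N + m ≤ (m + 2) ^ (a + 1) * 2 := by omega
  have h2 : lg (N + m) ≤ (a + 1) * lg (m + 2) + 1 + 2 :=
    calc lg (N + m) ≤ lg ((m + 2) ^ (a + 1) * 2) := lg_mono h1
      _ ≤ lg ((m + 2) ^ (a + 1)) + lg 2 := lg_mul_le _ _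
      _ ≤ ((a + 1) * lg (m + 2) + 1) + 2 := by
          rw [lg_two]; exact Nat.add_le_add_right (lg_pow_le _ _) _
  have h3 : lg (m + 2) ≤ lg m + 2 := by
    have := lg_add_le m 2
    rwa [lg_three] at this
  have h4 : 1 ≤ lg m := one_le_lg m
  have h5 : (a + 1) * lg (m + 2) ≤ (a + 1) * (lg m + 2) := Nat.mul_le_mul_left _ h3
  have h6 : (2 * a + 5) * 1 ≤ (2 * a + 5) * lg m := Nat.mul_le_mul_left _ h4
  calc lg (N + m) ≤ (a + 1) * lg (m + 2) + 1 + 2 := h2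
    _ ≤ (a + 1) * (lg m + 2) + 3 := by omega
    _ = (a + 1) * lg m + (2 * a + 5) * 1 := by ring
    _ ≤ (a + 1) * lg m + (2 * a + 5) * lg m := Nat.add_le_add_left h6 _
    _ = (3 * a + 6) * lg m := by ring

/-- `⌊√Y⌋ ≤ C ⌊√X⌋ + C` whenever `Y ≤ C · X` (used with `Y = d · lg N · lg s`,
`X = d · lg m · lg s`). [folklore] -/
theorem sqrt_le_of_le_mul {Y C X : ℕ} (hC : 1 ≤ C) (h : Y ≤ C * X) :
    Nat.sqrt Y ≤ C * Nat.sqrt X + C := by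
  apply le_mul_sqrt_add
  have h1 : Nat.sqrt Y ≤ Nat.sqrt (C * X) := Nat.sqrt_le_sqrt h
  calc Nat.sqrt Y * Nat.sqrt Y ≤ Nat.sqrt (C * X) * Nat.sqrt (C * X) := Nat.mul_le_mul h1 h1
    _ ≤ C * X := Nat.sqrt_le (C * X)
    _ ≤ C * (C * X) := Nat.le_mul_of_pos_left _ hC
    _ = C * C * X := (mul_assoc _ _ _).symm

/-- The exponent bookkeeping of the padding: with `#τ ≤ m ^ a + a`,
`K ⌊√(d · lg(#τ + m) · lg s)⌋ + K ≤ K' ⌊√(d · lg m · lg s)⌋ + K'` for `K' = K (3a + 6) + K`.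
[folklore] -/
theorem exponent_le {K a N m d s : ℕ} (hN : N ≤ m ^ a + a) :
    K * Nat.sqrt (d * (Nat.log 2 (N + m) + 1) * (Nat.log 2 s + 1)) + K ≤
      (K * (3 * a + 6) + K) * Nat.sqrt (d * (Nat.log 2 m + 1) * (Nat.log 2 s + 1)) +
        (K * (3 * a + 6) + K) := by
  change K * Nat.sqrt (d * lg (N + m) * lg s) + K ≤
    (K * (3 * a + 6) + K) * Nat.sqrt (d * lg m * lg s) + (K * (3 * a + 6) + K)
  have hlg : lg (N + m) ≤ (3 * a + 6) * lg m := lg_card_add_le hN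
  have hmono : d * lg (N + m) * lg s ≤ (3 * a + 6) * (d * lg m * lg s) :=
    calc d * lg (N + m) * lg s ≤ d * ((3 * a + 6) * lg m) * lg s :=
          Nat.mul_le_mul_right _ (Nat.mul_le_mul_left _ hlg)
      _ = (3 * a + 6) * (d * lg m * lg s) := by ring
  have hsq : Nat.sqrt (d * lg (N + m) * lg s) ≤
      (3 * a + 6) * Nat.sqrt (d * lg m * lg s) + (3 * a + 6) :=
    sqrt_le_of_le_mul (by omega) hmono
  have hK : K * Nat.sqrt (d * lg (N + m) * lg s) ≤
      K * ((3 * a + 6) * Nat.sqrt (d * lg m * lg s) + (3 * a + 6)) := Nat.mul_le_mul_left _ hsq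
  have hnonneg : 0 ≤ K * Nat.sqrt (d * lg m * lg s) := Nat.zero_le _
  calc K * Nat.sqrt (d * lg (N + m) * lg s) + K
      ≤ K * ((3 * a + 6) * Nat.sqrt (d * lg m * lg s) + (3 * a + 6)) + K :=
        Nat.add_le_add_right hK _
    _ ≤ K * ((3 * a + 6) * Nat.sqrt (d * lg m * lg s) + (3 * a + 6)) + K +
          K * Nat.sqrt (d * lg m * lg s) := Nat.le_add_right _ _
    _ = (K * (3 * a + 6) + K) * Nat.sqrt (d * lg m * lg s) + (K * (3 * a + 6) + K) := by ring

end PaddedChasm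

open PaddedChasm

/-- **Registered stub `stub_paddedChasm`** (the depth-three chasm with a free size parameter, over
an arbitrary finite variable type): for every `a` there is `K` such that every `f ∈ ℂ[τ]` with
`deg f ≤ d ≤ m ^ a + a`, `#τ ≤ m ^ a + a`, `L(f) ≤ s` has a product-depth-`≤ 1` circuit with at
most `2 ^ (K ⌊√(d (log₂ m + 1)(log₂ s + 1))⌋ + K)` wires.  From the discharged `Fin n`-form
`sigmaPiSigma_edgeSize_le_of_complexity_holds` by padding the variables to `Fin (#τ + m)` and
renaming the circuit back along a left inverse.
[cite: Tavenas2015, Cor. 1] [cite: GuptaKamathKayalSaptharishi2016, Thm. 1.1] -/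
theorem stub_paddedChasm :
    ∀ a : ℕ, ∃ K : ℕ, ∀ {τ : Type} [Fintype τ] (m s d : ℕ) (f : MvPolynomial τ ℂ),
      f.totalDegree ≤ d → d ≤ m ^ a + a → Fintype.card τ ≤ m ^ a + a → complexity f ≤ s →
        ∃ P : ArithCircuit ℂ τ, P.Computes f ∧ P.productDepth ≤ 1 ∧
          P.edgeSize ≤ 2 ^ (K * Nat.sqrt (d * (Nat.log 2 m + 1) * (Nat.log 2 s + 1)) + K) := by
  intro a
  obtain ⟨K, hK⟩ := sigmaPiSigma_edgeSize_le_of_complexity_holds a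
  refine ⟨K * (3 * a + 6) + K, ?_⟩
  intro τ _ m s d f hfd hda hcard hs
  -- the wire bound at `N = #τ + m` variables is below the claimed one
  have hexp := Nat.pow_le_pow_right two_pos (exponent_le (K := K) (d := d) (s := s) hcard)
  cases isEmpty_or_nonempty τ with
  | inl hτ =>
    -- no variables: `f` is a constant, computed by a gate-free circuit
    refine ⟨ArithCircuit.ofConst (coeff 0 f), ?_, ?_, (Nat.zero_le _).trans hexp⟩
    · rw [ArithCircuit.Computes, ArithCircuit.eval_ofConst]
      exact (eq_C_of_isEmpty f).symm
    · rw [DepthReduction.productDepth_ofConst]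
      exact Nat.zero_le _
  | inr hτ =>
    -- pad the variables: `ι : τ ↪ Fin (#τ + m)`, left inverse `ρ`
    set N := Fintype.card τ + m with hN
    let ι : τ ↪ Fin N := (Fintype.equivFin τ).toEmbedding.trans (Fin.castAddEmb m)
    obtain ⟨ρ, hρ⟩ := ι.injective.hasLeftInverse
    have hfd' : (rename ι f).totalDegree ≤ d := (totalDegree_rename_le _ f).trans hfd
    have hmN : m ≤ N := Nat.le_add_left _ _
    have hda' : d ≤ N ^ a + a := hda.trans (Nat.add_le_add_right (Nat.pow_le_pow_left hmN a) a)
    have hs' : complexity (rename ι f) ≤ s := (complexity_rename_le_holds' _ f).trans hs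
    obtain ⟨P, hP, hpd, hE⟩ := hK N s d (rename ι f) hfd' hda' hs'
    refine ⟨P.rename ρ, ?_, ?_, ?_⟩
    · rw [ArithCircuit.Computes, ArithCircuit.eval_rename_apply, hP, rename_rename, hρ.comp_eq_id,
        rename_id_apply]
    · rw [DepthThreeChasm.productDepth_rename]
      exact hpd
    · rw [DepthThreeChasm.edgeSize_rename]
      exact hE.trans hexp

end Summit.ValiantsHypothesis.ValiantsHypothesis.Theorems.ChowBorderDepth3Depth3Chasm

end
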